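import Literature.Combinatorics.SimpleGraph.GraphRiemannRoch
import HarnessLib

/-!
# The Abel–Jacobi maps `S^{(k)} : Div₊^k(G) → Jac(G)`: surjective iff `k ≥ g`, injective iff `G` is
# `(k+1)`-edge-connected (Baker–Norine 2007, Lemma 4.1, Theorems 1.7 and 1.8)

Source (held, read at the page; statements VERBATIM). M. Baker, S. Norine, *Riemann–Roch and
Abel–Jacobi theory on a finite graph*, Adv. Math. 215 (2007) 766–788 [BakerNorine2007] (held text
`paper:doi-10-1016-j-aim-2007-04-012` pp. 2, 4–6, 16–18). §1.2: «define a cut to be the set of all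
edges connecting a vertex in `V₁` to a vertex in `V₂` for some partition of `V(G)` into disjoint
non-empty subsets `V₁` and `V₂`. Then `G` is `k`-edge-connected if and only if every cut has size
at least `k`.» §1.3 (1.5): «`Jac(G) = Div⁰(G)/Prin(G)`. As shown in [BDN], `Jac(G)` is a finite
abelian group whose order `κ(G)` is the number of spanning trees in `G`.» §1.4: «If we fix a base
point `v₀ ∈ V(G)`, we can define the Abel–Jacobi map `S_{v₀} : G → Jac(G)` by the formula (1.6)
`S_{v₀}(v) = [(v) − (v₀)]`. We also define, for each natural number `k ≥ 1`, a map
`S_{v₀}^{(k)} : Div₊^k(G) → Jac(G)` by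
`S_{v₀}^{(k)}((v₁) + ⋯ + (v_k)) = S_{v₀}(v₁) + S_{v₀}(v₂) + ⋯ + S_{v₀}(v_k)`. […] **Theorem 1.7.**
The map `S^{(k)}` is surjective if and only if `k ≥ g`. […] **Theorem 1.8.** The map `S^{(k)}` is
injective if and only if `G` is `(k+1)`-edge-connected.» §4: «**Lemma 4.1.** 1. `S_{v₀}^{(k)}` is
injective if and only if whenever `D, D′` are effective divisors of degree `k` with `D ∼ D′`, we
have `D = D′`. If `S_{v₀}^{(k)}` is injective, then `S_{v₀}^{(k′)}` is injective for all positive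
integers `k′ ≤ k`. 2. `S_{v₀}^{(k)}` is surjective if and only if every divisor of degree `k` is
linearly equivalent to an effective divisor. If `S_{v₀}^{(k)}` is surjective, then `S_{v₀}^{(k′)}`
is surjective for all integers `k′ ≥ k`. In particular, whether or not `S_{v₀}^{(k)}` is injective
(resp. surjective) is independent of the base point `v₀`. […] **Proof of Theorem 1.7.** This is an
easy consequence of the Riemann–Roch theorem for graphs. If `D` is a divisor of degree `d ≥ g`,
then since `r(K − D) ≥ −1`, Riemann–Roch implies that `r(D) ≥ 0` […] Conversely, (RR1) implies
that `𝒩 ≠ ∅`, and therefore `S^{(g−1)}` is not surjective. […] (proof of Theorem 1.8) Suppose `G`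
is `(k+1)`-edge-connected. Choose `v₀ ∈ V(G)` arbitrarily, and let `D ∈ Div₊^k(G)`. For every
non-empty `A ⊆ V(G) − {v₀}`, we have `Σ_{v∈A} D(v) ≤ k < Σ_{v∈A} outdeg_A(v)`, as
`Σ_{v∈A} outdeg_A(v)` is equal to the size of the edge cut between `A` and `V(G) − A`. Therefore
`D(v) < outdeg_A(v)` for some `v ∈ A`. It follows that `D` is `v₀`-reduced, so from
Proposition 3.1 we deduce that no two distinct divisors in `Div₊^k(G)` are equivalent […]
Conversely, suppose `G` is not `(k+1)`-edge-connected. Let `C ⊆ E(G)` be an edge cut of size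
`j ≤ k`, and let `X ⊆ V(G)` be one of the components of `G − C`. Let `D = Σ_{v∈X} |E_v ∩ C|(v)`
and `D′ = D − Δ(χ_X)`. Then […] `D′(v) = 0` (`v ∈ X`), `= |{e = vw ∈ E_v : w ∈ X}|` (`v ∉ X`).
Thus `D, D′ ≥ 0`, `D ∼ D′`, and `D ≠ D′`. It follows that the map `S^{(j)}` is not injective, and
consequently neither is `S^{(k)}`.»

## What is formalised (vocabulary of `GraphDivisors` … `GraphRiemannRoch`; the Jacobian
## `Jac(G) = Div⁰(G)/Prin(G)` is the lineage's `criticalGroup G`, of order the tree number by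
## `card_criticalGroup`; `G` connected where B–N use it)

* `mk_eq_mk_iff_linEquiv` (classes of degree-`0` divisors in `Jac(G)` agree iff `∼`);
* **`abelJacobi G v₀ k`** — `S_{v₀}^{(k)} : Div₊^k(G) → Jac(G)`, `E ↦ [E − k(v₀)]` on the subtype
  of effective divisors of degree `k`; `abelJacobi_eq_iff`;
* **Lemma 4.1** (1) `abelJacobi_injective_iff` and (2) `abelJacobi_surjective_iff` (so both
  properties are independent of `v₀`), with the monotonicity clauses
  `abelJacobi_injective_anti` / `abelJacobi_surjective_mono`;
* **Theorem 1.7** `abelJacobi_surjective_iff_genus_le` (`S^{(k)}` surjective iff `k ≥ g`);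
* **Theorem 1.8** with `(k+1)`-edge-connectivity in B–N's cut form («every cut has size at least
  `k + 1`», the cut of `A` having size `Σ_{v∈A} outdeg_A(v)`): `isReduced_of_le_cutSize`
  (effective degree-`k` divisors are `v₀`-reduced), `exists_ne_linEquiv_of_cut` (B–N's pair
  `D, D′ = D − Δ(χ_X)` on a cut), **`abelJacobi_injective_iff_forall_cut`**.

Definitions with bodies and theorems; no `sorry`; no named facts.
-/

open Finset SimpleGraph Matrix
open Literature.Combinatorics.SimpleGraph.ChipFiring

namespace Literature.Combinatorics.SimpleGraph.BakerNorine

variable {V : Type*} [Fintype V] [DecidableEq V] (G : SimpleGraph V) [DecidableRel G.Adj]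

/-! ### §1 The Jacobian and the Abel–Jacobi maps -/

section AbelJacobi

/-- Two degree-`0` divisors define the same element of `Jac(G) = Div⁰(G)/Prin(G)` iff they are
linearly equivalent («the Jacobian of `G` is the set of linear equivalence classes of degree zero
divisors on `G`»). [cite: BakerNorine2007, §1.3 (1.5) and §1.6] -/
theorem mk_eq_mk_iff_linEquiv (F F' : zeroSumLattice V) :
    (QuotientAddGroup.mk F : criticalGroup G) = QuotientAddGroup.mk F' ↔
      LinEquiv G (F : V → ℤ) (F' : V → ℤ) := by
  rw [QuotientAddGroup.eq, AddSubgroup.mem_addSubgroupOf, AddSubgroup.coe_add, AddSubgroup.coe_neg,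
    neg_add_eq_sub, linEquiv_iff, ← neg_sub, neg_mem_iff]

/-- `E − k(v₀)` has degree `0` for `E` of degree `k`. [cite: BakerNorine2007, §1.4] -/
theorem sub_single_mem_zeroSumLattice (v₀ : V) (k : ℕ) {E : V → ℤ} (hE : ∑ v, E v = k) :
    E - Pi.single v₀ (k : ℤ) ∈ zeroSumLattice V := by
  rw [mem_zeroSumLattice_iff]
  simp only [Pi.sub_apply, Finset.sum_sub_distrib, hE, Finset.sum_pi_single', mem_univ, if_true,
    sub_self]

/-- **The Abel–Jacobi map `S_{v₀}^{(k)} : Div₊^k(G) → Jac(G)`**,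
«`S_{v₀}^{(k)}((v₁) + ⋯ + (v_k)) = S_{v₀}(v₁) + ⋯ + S_{v₀}(v_k)`» with «`S_{v₀}(v) = [(v) − (v₀)]`»,
i.e. `E ↦ [E − k(v₀)]`, on the effective divisors of degree `k`.
[cite: BakerNorine2007, §1.4 (1.6)] -/
def abelJacobi (v₀ : V) (k : ℕ) (E : {E : V → ℤ // 0 ≤ E ∧ ∑ v, E v = k}) : criticalGroup G :=
  QuotientAddGroup.mk ⟨E.1 - Pi.single v₀ (k : ℤ), sub_single_mem_zeroSumLattice v₀ k E.2.2⟩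

/-- `S^{(k)}(E) = S^{(k)}(E′)` iff `E ∼ E′`. [cite: BakerNorine2007, Lemma 4.1 (proof idea)] -/
theorem abelJacobi_eq_iff (v₀ : V) (k : ℕ) (E E' : {E : V → ℤ // 0 ≤ E ∧ ∑ v, E v = k}) :
    abelJacobi G v₀ k E = abelJacobi G v₀ k E' ↔ LinEquiv G E.1 E'.1 := by
  rw [abelJacobi, abelJacobi, mk_eq_mk_iff_linEquiv]
  show LinEquiv G (E.1 - Pi.single v₀ (k : ℤ)) (E'.1 - Pi.single v₀ (k : ℤ)) ↔ _
  constructor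
  · intro h
    have := h.add_right (Pi.single v₀ (k : ℤ))
    rwa [sub_add_cancel, sub_add_cancel] at this
  · intro h
    exact h.sub_right _

/-- **Lemma 4.1 (1).** «`S_{v₀}^{(k)}` is injective if and only if whenever `D, D′` are effective
divisors of degree `k` with `D ∼ D′`, we have `D = D′`» (independent of `v₀`).
[cite: BakerNorine2007, Lemma 4.1 (1)] -/
theorem abelJacobi_injective_iff (v₀ : V) (k : ℕ) :
    Function.Injective (abelJacobi G v₀ k) ↔
      ∀ D D' : V → ℤ, 0 ≤ D → 0 ≤ D' → ∑ v, D v = k → ∑ v, D' v = k → LinEquiv G D D' → D = D' := by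
  constructor
  · intro h D D' hD hD' hs hs' hDD'
    have := @h ⟨D, hD, hs⟩ ⟨D', hD', hs'⟩ ((abelJacobi_eq_iff G v₀ k _ _).2 hDD')
    exact congrArg Subtype.val this
  · intro h E E' hEE'
    exact Subtype.ext (h E.1 E'.1 E.2.1 E'.2.1 E.2.2 E'.2.2 ((abelJacobi_eq_iff G v₀ k E E').1 hEE'))

/-- **Lemma 4.1 (2).** «`S_{v₀}^{(k)}` is surjective if and only if every divisor of degree `k` is
linearly equivalent to an effective divisor» (independent of `v₀`).
[cite: BakerNorine2007, Lemma 4.1 (2)] -/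
theorem abelJacobi_surjective_iff (v₀ : V) (k : ℕ) :
    Function.Surjective (abelJacobi G v₀ k) ↔ ∀ D : V → ℤ, ∑ v, D v = k → Winnable G D := by
  constructor
  · intro h D hD
    obtain ⟨E, hE⟩ := h (QuotientAddGroup.mk ⟨D - Pi.single v₀ (k : ℤ), sub_single_mem_zeroSumLattice v₀ k hD⟩)
    rw [abelJacobi, mk_eq_mk_iff_linEquiv] at hE
    have h' : LinEquiv G E.1 D := by
      have := LinEquiv.add_right hE (Pi.single v₀ (k : ℤ))
      simpa only [sub_add_cancel] using this
    exact ⟨E.1, E.2.1, h'.symm⟩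
  · intro h c
    obtain ⟨⟨F, hF⟩, rfl⟩ := QuotientAddGroup.mk_surjective c
    have hdeg : ∑ v, (F + Pi.single v₀ (k : ℤ) : V → ℤ) v = k := by
      rw [mem_zeroSumLattice_iff] at hF
      simp only [Pi.add_apply, Finset.sum_add_distrib, hF, Finset.sum_pi_single', mem_univ, if_true,
        zero_add]
    obtain ⟨E, hE, hFE⟩ := h _ hdeg
    refine ⟨⟨E, hE, by rw [← hFE.sum_eq, hdeg]⟩, ?_⟩
    rw [abelJacobi, mk_eq_mk_iff_linEquiv]
    show LinEquiv G (E - Pi.single v₀ (k : ℤ)) F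
    have := hFE.symm.sub_right (Pi.single v₀ (k : ℤ))
    rwa [add_sub_cancel_right] at this

/-- **Lemma 4.1 (2), monotonicity.** «If `S_{v₀}^{(k)}` is surjective, then `S_{v₀}^{(k′)}` is
surjective for all integers `k′ ≥ k`.» [cite: BakerNorine2007, Lemma 4.1 (2)] -/
theorem abelJacobi_surjective_mono (v₀ : V) {k k' : ℕ} (hk : k ≤ k')
    (h : Function.Surjective (abelJacobi G v₀ k)) : Function.Surjective (abelJacobi G v₀ k') := by
  rw [abelJacobi_surjective_iff] at h ⊢
  intro D hD
  have hW := h (D - Pi.single v₀ ((k' : ℤ) - k)) (by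
    simp only [Pi.sub_apply, Finset.sum_sub_distrib, hD, Finset.sum_pi_single', mem_univ, if_true]
    ring)
  have hF : (0 : V → ℤ) ≤ Pi.single v₀ ((k' : ℤ) - k) := fun v => by
    by_cases hv : v = v₀
    · subst hv
      simpa using hk
    · simp [hv]
  have := hW.add_nonneg hF
  rwa [sub_add_cancel] at this

/-- **Lemma 4.1 (1), monotonicity.** «If `S_{v₀}^{(k)}` is injective, then `S_{v₀}^{(k′)}` is
injective for all positive integers `k′ ≤ k`.» [cite: BakerNorine2007, Lemma 4.1 (1)] -/
theorem abelJacobi_injective_anti (v₀ : V) {k k' : ℕ} (hk : k' ≤ k)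
    (h : Function.Injective (abelJacobi G v₀ k)) : Function.Injective (abelJacobi G v₀ k') := by
  rw [abelJacobi_injective_iff] at h ⊢
  intro D D' hD hD' hs hs' hDD'
  have hF : (0 : V → ℤ) ≤ Pi.single v₀ ((k : ℤ) - k') := fun v => by
    by_cases hv : v = v₀
    · subst hv
      simpa using hk
    · simp [hv]
  have hsum : ∀ F : V → ℤ, ∑ v, F v = k' → ∑ v, (F + Pi.single v₀ ((k : ℤ) - k') : V → ℤ) v = k := by
    intro F hF
    simp only [Pi.add_apply, Finset.sum_add_distrib, hF, Finset.sum_pi_single', mem_univ, if_true]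
    ring
  have := h (D + Pi.single v₀ ((k : ℤ) - k')) (D' + Pi.single v₀ ((k : ℤ) - k'))
    (add_nonneg hD hF) (add_nonneg hD' hF) (hsum D hs) (hsum D' hs') (hDD'.add_right _)
  exact add_right_cancel this

variable {G} in
/-- **Theorem 1.7.** «The map `S^{(k)}` is surjective if and only if `k ≥ g`» (`G` connected;
«an easy consequence of the Riemann–Roch theorem for graphs», via Theorem 1.9).
[cite: BakerNorine2007, Theorem 1.7] -/
theorem abelJacobi_surjective_iff_genus_le (hG : G.Connected) (v₀ : V) (k : ℕ) :
    Function.Surjective (abelJacobi G v₀ k) ↔ genus G ≤ k := by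
  rw [abelJacobi_surjective_iff, forall_winnable_iff_genus_le hG]

end AbelJacobi

/-! ### §2 Theorem 1.8: injectivity and edge-connectivity -/

section EdgeConnectivity

variable {G}

/-- Under «every cut has size at least `k + 1`» (the cut of `A` having size
`Σ_{v∈A} outdeg_A(v)`), every effective divisor of degree `k` is `v₀`-reduced («For every
non-empty `A ⊆ V(G) − {v₀}`, we have `Σ_{v∈A} D(v) ≤ k < Σ_{v∈A} outdeg_A(v)` […] Therefore
`D(v) < outdeg_A(v)` for some `v ∈ A`»). [cite: BakerNorine2007, Theorem 1.8 (proof)] -/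
theorem isReduced_of_le_cutSize {k : ℕ} (v₀ : V)
    (hcut : ∀ A : Finset V, A.Nonempty → Aᶜ.Nonempty → (k : ℤ) + 1 ≤ ∑ v ∈ A, (#(G.neighborFinset v \ A) : ℤ))
    {D : V → ℤ} (hD : 0 ≤ D) (hdeg : ∑ v, D v = k) : IsReduced G v₀ D := by
  refine ⟨fun v _ => hD v, fun A hA hq => ?_⟩
  by_contra hcon
  push Not at hcon
  have h1 : ∑ v ∈ A, (#(G.neighborFinset v \ A) : ℤ) ≤ ∑ v ∈ A, D v := Finset.sum_le_sum hcon
  have h2 : ∑ v ∈ A, D v ≤ ∑ v, D v :=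
    Finset.sum_le_sum_of_subset_of_nonneg (Finset.subset_univ A) fun v _ _ => hD v
  have h3 := hcut A hA ⟨v₀, Finset.mem_compl.2 hq⟩
  omega

/-- **Theorem 1.8 (⇐).** If every cut of `G` has size at least `k + 1`, then `S^{(k)}` is
injective («`D` is `v₀`-reduced, so from Proposition 3.1 we deduce that no two distinct divisors
in `Div₊^k(G)` are equivalent»). [cite: BakerNorine2007, Theorem 1.8] -/
theorem abelJacobi_injective_of_le_cutSize (v₀ : V) {k : ℕ}
    (hcut : ∀ A : Finset V, A.Nonempty → Aᶜ.Nonempty → (k : ℤ) + 1 ≤ ∑ v ∈ A, (#(G.neighborFinset v \ A) : ℤ)) :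
    Function.Injective (abelJacobi G v₀ k) := by
  rw [abelJacobi_injective_iff]
  intro D D' hD hD' hs hs' hDD'
  exact (isReduced_of_le_cutSize v₀ hcut hD hs).eq_of_linEquiv (isReduced_of_le_cutSize v₀ hcut hD' hs') hDD'

/-- B–N's pair of distinct equivalent effective divisors on a cut («Let `D = Σ_{v∈X} |E_v ∩ C|(v)`
and `D′ = D − Δ(χ_X)`. Then […] `D, D′ ≥ 0`, `D ∼ D′`, and `D ≠ D′`»), for a connected graph and a
vertex set `X` with non-empty complement; `deg D` is the size of the cut.
[cite: BakerNorine2007, Theorem 1.8 (proof)] -/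
theorem exists_ne_linEquiv_of_cut (hG : G.Connected) {X : Finset V} (hX : X.Nonempty)
    (hXc : Xᶜ.Nonempty) :
    ∃ D D' : V → ℤ, 0 ≤ D ∧ 0 ≤ D' ∧ LinEquiv G D D' ∧ D ≠ D' ∧
      ∑ v, D v = ∑ v ∈ X, (#(G.neighborFinset v \ X) : ℤ) := by
  set D : V → ℤ := fun v => if v ∈ X then (#(G.neighborFinset v \ X) : ℤ) else 0 with hDdef
  have hD : 0 ≤ D := fun v => by
    rw [Pi.zero_apply, hDdef]
    dsimp only
    split_ifs <;> positivity
  refine ⟨D, D - G.lapMatrix ℤ *ᵥ charFun X, hD, fun v => ?_, linEquiv_sub_mulVec G D _, ?_, ?_⟩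
  · rw [Pi.zero_apply]
    by_cases hv : v ∈ X
    · rw [sub_mulVec_charFun_apply_of_mem G D hv, hDdef]
      simp [hv]
    · rw [sub_mulVec_charFun_apply_of_not_mem G D hv]
      exact add_nonneg (hD v) (by positivity)
  · -- an edge crosses the cut: some `a ∈ X` has a neighbour outside `X`, so `D(a) > 0 = D′(a)`
    obtain ⟨a, ha⟩ := hX
    obtain ⟨b, hb⟩ := hXc
    obtain ⟨p⟩ := hG.preconnected a b
    obtain ⟨d, -, hd1, hd2⟩ := p.exists_boundary_dart (X : Set V) (by exact_mod_cast ha)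
      (by exact_mod_cast Finset.mem_compl.1 hb)
    intro heq
    have h1 := congrFun heq d.fst
    have hfst : d.fst ∈ X := by exact_mod_cast hd1
    have hsnd : d.snd ∉ X := by exact_mod_cast hd2
    rw [sub_mulVec_charFun_apply_of_mem G D hfst] at h1
    have hpos : 0 < #(G.neighborFinset d.fst \ X) :=
      Finset.card_pos.2 ⟨d.snd, Finset.mem_sdiff.2 ⟨(mem_neighborFinset G d.fst d.snd).2 d.adj, hsnd⟩⟩
    omega
  · rw [hDdef]
    rw [← Finset.sum_filter, Finset.filter_mem_eq_inter, Finset.univ_inter]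

/-- **Theorem 1.8.** «The map `S^{(k)}` is injective if and only if `G` is `(k+1)`-edge-connected»,
with «`G` is `k`-edge-connected if and only if every cut has size at least `k`» (`G` connected; the
cut determined by `A` has size `Σ_{v∈A} outdeg_A(v)`). [cite: BakerNorine2007, Theorem 1.8 (with §1.2)] -/
theorem abelJacobi_injective_iff_forall_cut (hG : G.Connected) (v₀ : V) (k : ℕ) :
    Function.Injective (abelJacobi G v₀ k) ↔
      ∀ A : Finset V, A.Nonempty → Aᶜ.Nonempty → (k : ℤ) + 1 ≤ ∑ v ∈ A, (#(G.neighborFinset v \ A) : ℤ) := by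
  refine ⟨fun h => ?_, abelJacobi_injective_of_le_cutSize v₀⟩
  intro A hA hAc
  by_contra hlt
  push Not at hlt
  -- a cut of size `j ≤ k`: B–N's pair, padded by `(k − j)(v₀)`, contradicts injectivity
  obtain ⟨D, D', hD, hD', hDD', hne, hdeg⟩ := exists_ne_linEquiv_of_cut hG hA hAc
  obtain ⟨j, hj⟩ := Int.eq_ofNat_of_zero_le (Finset.sum_nonneg fun v (_ : v ∈ univ) => hD v)
  have hjk : j ≤ k := by
    have : (j : ℤ) ≤ k := by rw [← hj, hdeg]; omega
    exact_mod_cast this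
  have hinj := abelJacobi_injective_anti G v₀ hjk h
  rw [abelJacobi_injective_iff] at hinj
  exact hne (hinj D D' hD hD' hj (by rw [← hDD'.sum_eq, hj]) hDD')

end EdgeConnectivity

end Literature.Combinatorics.SimpleGraph.BakerNorine
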